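import Summits.AtomisticToContinuum.FouriersLaw.Theses.OddSectorIrreversibility
import Literature.Barriers.AtomisticToContinuum.FixedLengthNoConductivityControl

/-!
# `OddSectorIrreversibility.BoundedResponse` — reductions (support for stmt-AtomisticToContinuum-10924)

The shared support item `BoundedResponse` (wanted by `OddSectorIrreversibility`, `LocalOhmBV`,
`MatthiessenLadder`) is, verbatim, the catalogued necessary waypoint
`Literature.Barriers.AtomisticToContinuum.HasBoundedResponse (pinnedChain ω₂ lam β γ)` under
weak-NESS uniqueness (`boundedResponse_iff_forall_hasBoundedResponse`, `Iff.rfl`): length-uniform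
boundedness of the finite-size conductivities `D_N = lim_{δ→0,δ≠0} totalCurrent(μ_{N,T+δ/2,T-δ/2})/δ`
(Bonetto–Lebowitz–Rey-Bellet 2000 §6.3: "nothing is known about the dependence of `D` on `L`").
Its mathematical content is an open problem; this file records the bookkeeping every closing
argument (the route's `WitnessGlue`, the sibling routes' `LocalOhmGlue` / `LimitGlue`) ends with,
so that a supplier only has to produce an EVENTUAL bound along ONE steady-state family:

* `boundedResponse_iff_forall_hasBoundedResponse`, `boundedResponse_of_forall_hasBoundedResponse` —
  the item is the Barriers predicate under uniqueness; an unconditional proof of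
  `HasBoundedResponse (pinnedChain …)` at every admissible parameter point closes it.
* `bddAbove_range_abs_of_eventually_abs_le`, `bddAbove_range_abs_of_eventually_nonneg_le` —
  `BddAbove (range |D|)` from a bound valid for `N ≥ N₀` only (finitely many small `N` are free),
  in the two-sided shape `0 ≤ D_N ≤ C` in which transport-witness / Cauchy–Schwarz arguments
  deliver it.
* `responseCoeff_eq_zero_of_le_one` — chains with `N ≤ 1` sites have no bond, `totalCurrent = 0`
  for every measure, so their response coefficient is `0` along any family.
* `boundedResponse_of_one_family` — under the item's uniqueness hypothesis it suffices to bound the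
  response coefficients along ONE steady-state family of one's choosing (e.g. the family through the
  Gibbs state at equal temperatures), eventually in `N`
  (`Literature.Barriers.AtomisticToContinuum.hasBoundedResponse_iff_of_unique`).
* `boundedResponse_iff_exists_family` — the same as an equivalence (existence of a family from the
  landed `pinnedChain_exists_isSteadyState`).

All sorry-free; nothing here closes the item.
-/

noncomputable section

namespace Summit.AtomisticToContinuum.FouriersLaw.Theorems

open MeasureTheory Filter Topology Set
open Literature.MathematicalPhysics.KineticTheory.HeatConduction
open Literature.Barriers.AtomisticToContinuum (HasBoundedResponse hasBoundedResponse_iff_of_unique)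
open Summit.AtomisticToContinuum.FouriersLaw.Theses.OddSectorIrreversibility (BoundedResponse)

/-- `BoundedResponse` is, by definition, the Barriers predicate `HasBoundedResponse (pinnedChain …)`
under weak-NESS uniqueness at every admissible parameter point. [folklore] -/
theorem boundedResponse_iff_forall_hasBoundedResponse :
    BoundedResponse ↔ ∀ ω₂ lam β γ : ℝ, 0 < ω₂ → 0 < lam → 0 < β → 0 < γ →
      (∀ (N : ℕ) (T_L T_R : ℝ), 0 < T_L → 0 < T_R → ∀ μ ν : Measure (PhaseSpace N),
        (pinnedChain ω₂ lam β γ).IsSteadyState N T_L T_R μ →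
          (pinnedChain ω₂ lam β γ).IsSteadyState N T_L T_R ν → μ = ν) →
      HasBoundedResponse (pinnedChain ω₂ lam β γ) :=
  Iff.rfl

/-- An unconditional proof of the Barriers predicate at every admissible parameter point closes the
item (the uniqueness hypothesis is simply dropped). [folklore] -/
theorem boundedResponse_of_forall_hasBoundedResponse
    (h : ∀ ω₂ lam β γ : ℝ, 0 < ω₂ → 0 < lam → 0 < β → 0 < γ →
      HasBoundedResponse (pinnedChain ω₂ lam β γ)) :
    BoundedResponse :=
  fun ω₂ lam β γ hω hl hβ hγ _ => h ω₂ lam β γ hω hl hβ hγ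

/-- Finitely many lengths are free: a bound `|D N| ≤ C` for all large `N` already gives
`BddAbove (range |D|)`. [folklore] -/
theorem bddAbove_range_abs_of_eventually_abs_le {D : ℕ → ℝ} {C : ℝ}
    (h : ∀ᶠ N in atTop, |D N| ≤ C) : BddAbove (Set.range fun N => |D N|) :=
  (Filter.isBoundedUnder_of_eventually_le (f := atTop) (u := fun N => |D N|) h).bddAbove_range

/-- The two-sided eventual shape delivered by transport-witness (Cauchy–Schwarz) arguments:
`0 ≤ D N` and `D N ≤ C` for all large `N` give `BddAbove (range |D|)`. [folklore] -/
theorem bddAbove_range_abs_of_eventually_nonneg_le {D : ℕ → ℝ} {C : ℝ}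
    (h₀ : ∀ᶠ N in atTop, 0 ≤ D N) (h₁ : ∀ᶠ N in atTop, D N ≤ C) :
    BddAbove (Set.range fun N => |D N|) :=
  bddAbove_range_abs_of_eventually_abs_le
    (C := C) (by filter_upwards [h₀, h₁] with N h0 h1; rwa [abs_of_nonneg h0])

/-- A chain with at most one site has no bond: its total current vanishes for EVERY measure.
[folklore] -/
theorem totalCurrent_eq_zero_of_le_one (P : OscillatorChain) {N : ℕ} (hN : N ≤ 1)
    (μ : Measure (PhaseSpace N)) : P.totalCurrent μ = 0 := by
  unfold OscillatorChain.totalCurrent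
  refine Finset.sum_eq_zero fun i _ => ?_
  have hb : ∀ x, P.bondCurrent N i x = 0 := fun x => by
    unfold OscillatorChain.bondCurrent
    refine Finset.sum_eq_zero fun j _ => ?_
    have hj : j.val ≠ i.val + 1 := by have := j.isLt; have := i.isLt; omega
    simp [hj]
  simp [hb]

/-- Hence along ANY family the response coefficient of a chain with `N ≤ 1` sites is `0`
(the difference quotients vanish identically; limits along the proper filter `𝓝[≠] 0` are unique).
[folklore] -/
theorem responseCoeff_eq_zero_of_le_one (P : OscillatorChain) {N : ℕ} (hN : N ≤ 1)
    (μ : ℝ → ℝ → Measure (PhaseSpace N)) {T d : ℝ}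
    (hd : Tendsto (fun δ : ℝ => P.totalCurrent (μ (T + δ / 2) (T - δ / 2)) / δ)
      (𝓝[≠] 0) (𝓝 d)) : d = 0 := by
  have h0 : (fun δ : ℝ => P.totalCurrent (μ (T + δ / 2) (T - δ / 2)) / δ) = fun _ => 0 := by
    funext δ; rw [totalCurrent_eq_zero_of_le_one P hN, zero_div]
  rw [h0] at hd
  exact tendsto_nhds_unique hd tendsto_const_nhds

/-- **One family, eventually, suffices.** Under the item's weak-NESS uniqueness hypothesis the
family quantifier collapses (`hasBoundedResponse_iff_of_unique`): to prove `BoundedResponse` it is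
enough, at each admissible parameter point, to exhibit ONE steady-state family `μ₀` (e.g. the one
through the Gibbs state at equal temperatures) along which every sequence of response coefficients
is bounded in absolute value for all large `N`. [folklore] -/
theorem boundedResponse_of_one_family
    (h : ∀ ω₂ lam β γ : ℝ, 0 < ω₂ → 0 < lam → 0 < β → 0 < γ →
      (∀ (N : ℕ) (T_L T_R : ℝ), 0 < T_L → 0 < T_R → ∀ μ ν : Measure (PhaseSpace N),
        (pinnedChain ω₂ lam β γ).IsSteadyState N T_L T_R μ →
          (pinnedChain ω₂ lam β γ).IsSteadyState N T_L T_R ν → μ = ν) →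
      ∃ μ₀ : (N : ℕ) → ℝ → ℝ → Measure (PhaseSpace N),
        (∀ (N : ℕ) (T_L T_R : ℝ), 0 < T_L → 0 < T_R →
          (pinnedChain ω₂ lam β γ).IsSteadyState N T_L T_R (μ₀ N T_L T_R)) ∧
        ∀ T : ℝ, 0 < T → ∀ D : ℕ → ℝ,
          (∀ N : ℕ, Tendsto (fun δ : ℝ =>
              (pinnedChain ω₂ lam β γ).totalCurrent (μ₀ N (T + δ / 2) (T - δ / 2)) / δ)
            (𝓝[≠] 0) (𝓝 (D N))) →
          ∃ C : ℝ, ∀ᶠ N in atTop, |D N| ≤ C) :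
    BoundedResponse := by
  intro ω₂ lam β γ hω hl hβ hγ hU
  obtain ⟨μ₀, hμ₀, hB⟩ := h ω₂ lam β γ hω hl hβ hγ hU
  show HasBoundedResponse (pinnedChain ω₂ lam β γ)
  refine (hasBoundedResponse_iff_of_unique hU μ₀ hμ₀).2 fun T hT D hD => ?_
  obtain ⟨C, hC⟩ := hB T hT D hD
  exact bddAbove_range_abs_of_eventually_abs_le hC

/-- The same collapse as an equivalence: `BoundedResponse` holds iff at every admissible parameter
point with unique weak steady states SOME steady-state family has eventually bounded response
coefficients (→: any family works, and one exists by the landed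
`pinnedChain_exists_isSteadyState`; ←: `boundedResponse_of_one_family`). [folklore] -/
theorem boundedResponse_iff_exists_family :
    BoundedResponse ↔ ∀ ω₂ lam β γ : ℝ, 0 < ω₂ → 0 < lam → 0 < β → 0 < γ →
      (∀ (N : ℕ) (T_L T_R : ℝ), 0 < T_L → 0 < T_R → ∀ μ ν : Measure (PhaseSpace N),
        (pinnedChain ω₂ lam β γ).IsSteadyState N T_L T_R μ →
          (pinnedChain ω₂ lam β γ).IsSteadyState N T_L T_R ν → μ = ν) →
      ∃ μ₀ : (N : ℕ) → ℝ → ℝ → Measure (PhaseSpace N),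
        (∀ (N : ℕ) (T_L T_R : ℝ), 0 < T_L → 0 < T_R →
          (pinnedChain ω₂ lam β γ).IsSteadyState N T_L T_R (μ₀ N T_L T_R)) ∧
        ∀ T : ℝ, 0 < T → ∀ D : ℕ → ℝ,
          (∀ N : ℕ, Tendsto (fun δ : ℝ =>
              (pinnedChain ω₂ lam β γ).totalCurrent (μ₀ N (T + δ / 2) (T - δ / 2)) / δ)
            (𝓝[≠] 0) (𝓝 (D N))) →
          ∃ C : ℝ, ∀ᶠ N in atTop, |D N| ≤ C := by
  refine ⟨fun hB ω₂ lam β γ hω hl hβ hγ hU => ?_, boundedResponse_of_one_family⟩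
  classical
  -- a steady-state family from the landed existence theorem (junk `0` at non-positive temperatures)
  have hex : ∀ (N : ℕ) (T_L T_R : ℝ), 0 < T_L → 0 < T_R →
      ∃ μ : Measure (PhaseSpace N), (pinnedChain ω₂ lam β γ).IsSteadyState N T_L T_R μ :=
    fun N T_L T_R h1 h2 => pinnedChain_exists_isSteadyState hω hl hβ hγ N h1 h2
  let μ₀ : (N : ℕ) → ℝ → ℝ → Measure (PhaseSpace N) := fun N T_L T_R =>
    if h12 : 0 < T_L ∧ 0 < T_R then Classical.choose (hex N T_L T_R h12.1 h12.2) else 0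
  have hμ₀ : ∀ (N : ℕ) (T_L T_R : ℝ), 0 < T_L → 0 < T_R →
      (pinnedChain ω₂ lam β γ).IsSteadyState N T_L T_R (μ₀ N T_L T_R) := by
    intro N T_L T_R h1 h2
    simp only [μ₀, dif_pos (And.intro h1 h2)]
    exact Classical.choose_spec (hex N T_L T_R h1 h2)
  refine ⟨μ₀, hμ₀, fun T hT D hD => ?_⟩
  obtain ⟨C, hC⟩ := hB ω₂ lam β γ hω hl hβ hγ hU μ₀ hμ₀ T hT D hD
  exact ⟨C, Filter.Eventually.of_forall fun N => hC ⟨N, rfl⟩⟩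

end Summit.AtomisticToContinuum.FouriersLaw.Theorems

end
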